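import Literature.Topology.FourManifolds.TubeConeify
import HarnessLib

/-!
# Exports of the cone-ification zone: tangential derivative, quantitative invertibility, Euler defect

Topic `Literature/Topology/FourManifolds`; sequel of `TubeConeify.lean` (codimension `≥ 2` step of the
smoothing of PD homeomorphisms: Munkres, Ann. of Math. 72 (1960), §§4–5; Campbell–D'Onofrio–Vítek,
J. Geom. Anal. (2026), Lemma 3.2).  With `φ = coneifyMap N μ`, `t = ‖y‖`, `m = μ t`, reading point
`q = coneifyPoint μ p`, pacing exponent `κ = t μ'/m` and target defect `d = DN(q)(0, q.2) − N q`, the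
three **pointwise exports** for the next stage (`ExportAlgebra.lean`) are:

* (E1) `fderiv_coneifyMap_apply_inl`: `Dφ p (v, 0) = (t/m) • DN(q)(v, 0)` (factor `t/m ≤ 1`;
  the tangential derivative of `N` is read at `q`);
* (E2) `coneifyMap_fibre_lower_bound`: if `c_N‖w‖ ≤ ‖DN(q)(0,w)‖`, `‖d‖ ≤ d₀` and `|1 − κ| ≤ K₀`
  then `(c_N − K₀ d₀ / m) ‖w‖ ≤ ‖Dφ p (0, w)‖`;
* (E3) `coneifyMap_euler_defect`: `Dφ p (0, y) − φ p = (t κ / m) • d` — zero on the exact cone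
  (`κ = 0`), and `≤ t (1 + K₀) d₀ / m` in norm in general (`norm_coneifyMap_euler_defect_le`).

Everything is proved; no definitions; no named facts.

## References

* J. R. Munkres, *Obstructions to the smoothing of piecewise-differentiable homeomorphisms*, Ann.
  of Math. (2) 72 (1960), 521–554, §§4–5. [Munkres1960]
* D. Campbell, L. D'Onofrio, T. Vítek, *Diffeomorphic approximation of piecewise affine
  homeomorphisms*, J. Geom. Anal. 36 (2026), Lemma 3.2. [CampbellDonofrioVitek2026]
-/

noncomputable section

open Set Function Metric Filter
open scoped Topology ContDiff RealInnerProductSpace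

namespace Literature.Topology.FourManifolds

variable {E : Type*} [NormedAddCommGroup E] [NormedSpace ℝ E]
variable {F : Type*} [NormedAddCommGroup F] [InnerProductSpace ℝ F]
variable {N : E × F → F} {μ : ℝ → ℝ} {p : E × F}

/-- `∞ ≠ 0` (bookkeeping). [folklore] -/
private theorem cone_infty_ne_zero : (∞ : WithTop ℕ∞) ≠ 0 := by
  simp

/-- **(E1) The tangential derivative of cone-ification**: `Dφ p (v, 0) = (t / μ t) • DN(q)(v, 0)`
(varying `x` does not move the reading radius). [folklore] -/
theorem fderiv_coneifyMap_apply_inl (hp : p.2 ≠ 0) (hN : ContDiffAt ℝ ∞ N (coneifyPoint μ p))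
    (hμ : ContDiffAt ℝ ∞ μ ‖p.2‖) (hμ0 : μ ‖p.2‖ ≠ 0) (v : E) :
    fderiv ℝ (coneifyMap N μ) p (v, 0) =
      (‖p.2‖ / μ ‖p.2‖) • fderiv ℝ N (coneifyPoint μ p) (v, 0) := by
  -- derivative along the line `τ ↦ (x + τ v, y)`
  have hd : DifferentiableAt ℝ (coneifyMap N μ) p :=
    (contDiffAt_coneifyMap hp hN hμ hμ0).differentiableAt cone_infty_ne_zero
  have hl : HasDerivAt (fun τ : ℝ => p.1 + τ • v) v 0 := by
    have h := ((hasDerivAt_id (0 : ℝ)).smul_const v).const_add p.1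
    rw [one_smul] at h
    exact h
  have hline : HasDerivAt (fun τ : ℝ => ((p.1 + τ • v, p.2) : E × F)) ((v, (0 : F)) : E × F) 0 :=
    hl.prodMk (hasDerivAt_const (0 : ℝ) p.2)
  have h1 : HasDerivAt (fun τ : ℝ => coneifyMap N μ (p.1 + τ • v, p.2))
      (fderiv ℝ (coneifyMap N μ) p (v, 0)) 0 :=
    hd.hasFDerivAt.comp_hasDerivAt_of_eq (0 : ℝ) hline (by simp)
  -- the same derivative from the formula: only `N` moves, at the reading point
  have hq : HasDerivAt (fun τ : ℝ => ((p.1 + τ • v, (μ ‖p.2‖ / ‖p.2‖) • p.2) : E × F))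
      ((v, (0 : F)) : E × F) 0 :=
    hl.prodMk (hasDerivAt_const (0 : ℝ) _)
  have hNd : HasFDerivAt N (fderiv ℝ N (coneifyPoint μ p)) (coneifyPoint μ p) :=
    (hN.differentiableAt cone_infty_ne_zero).hasFDerivAt
  have h2' : HasDerivAt (fun τ : ℝ => N (p.1 + τ • v, (μ ‖p.2‖ / ‖p.2‖) • p.2))
      (fderiv ℝ N (coneifyPoint μ p) (v, 0)) 0 :=
    hNd.comp_hasDerivAt_of_eq (0 : ℝ) hq (by simp [coneifyPoint])
  have h2 : HasDerivAt (fun τ : ℝ => coneifyMap N μ (p.1 + τ • v, p.2))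
      ((‖p.2‖ / μ ‖p.2‖) • fderiv ℝ N (coneifyPoint μ p) (v, 0)) 0 := by
    have := h2'.const_smul (‖p.2‖ / μ ‖p.2‖)
    exact this
  exact h1.unique h2

/-- **(E3) The Euler defect of cone-ification**: `Dφ p (0, y) − φ p = (t κ / m) • d` with
`κ = t μ'(t)/m`, `m = μ t`, `d = DN(q)(0, q.2) − N q`. [folklore] -/
theorem coneifyMap_euler_defect (hp : p.2 ≠ 0) (hN : ContDiffAt ℝ ∞ N (coneifyPoint μ p))
    (hμ : ContDiffAt ℝ ∞ μ ‖p.2‖) (hμ0 : μ ‖p.2‖ ≠ 0) :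
    fderiv ℝ (coneifyMap N μ) p (0, p.2) - coneifyMap N μ p =
      (‖p.2‖ * (‖p.2‖ * deriv μ ‖p.2‖ / μ ‖p.2‖) / μ ‖p.2‖) •
        (fderiv ℝ N (coneifyPoint μ p) (0, (coneifyPoint μ p).2) - N (coneifyPoint μ p)) := by
  set t : ℝ := ‖p.2‖ with ht
  have ht0 : 0 < t := norm_pos_iff.2 hp
  set m : ℝ := μ ‖p.2‖ with hm
  set q := coneifyPoint μ p with hq
  set d : F := fderiv ℝ N q (0, q.2) - N q with hd
  rw [fderiv_coneifyMap_apply_inr hp hN hμ hμ0 p.2]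
  -- `⟪ŷ, y⟫ = t`, `y = (t/m) • q.2`, `φ p = (t/m) • N q`
  have hyy : ⟪‖p.2‖⁻¹ • p.2, p.2⟫ = t := by
    rw [real_inner_smul_left, real_inner_self_eq_norm_sq, ← ht, pow_two, ← mul_assoc,
      inv_mul_cancel₀ ht0.ne', one_mul]
  have hy : p.2 = (t / m) • q.2 := by
    rw [hq, coneifyPoint]
    simp only [smul_smul, ← ht]
    rw [div_mul_div_comm, mul_comm t m, div_self (mul_ne_zero hμ0 ht0.ne'), one_smul]
  have hDy : fderiv ℝ N q (0, p.2) = (t / m) • fderiv ℝ N q (0, q.2) := by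
    conv_lhs => rw [hy]
    rw [← map_smul]
    congr 1
    ext <;> simp
  have hφ : coneifyMap N μ p = (t / m) • N q := rfl
  rw [hyy, hDy, hφ]
  -- algebra
  have e : (t / m) • fderiv ℝ N q (0, q.2) - (t * (1 - ‖p.2‖ * deriv μ ‖p.2‖ / μ ‖p.2‖) / μ ‖p.2‖) • d -
      (t / m) • N q = (t / m - t * (1 - ‖p.2‖ * deriv μ ‖p.2‖ / μ ‖p.2‖) / μ ‖p.2‖) • d := by
    rw [hd]
    module
  rw [e]
  congr 1
  rw [← hm, ← ht]
  field_simp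
  ring

/-- Norm form of (E3): `‖Dφ p (0, y) − φ p‖ ≤ t (1 + K₀) d₀ / m` when `‖d‖ ≤ d₀`, `|1 − κ| ≤ K₀`,
`m = μ t > 0`. [folklore] -/
theorem norm_coneifyMap_euler_defect_le (hp : p.2 ≠ 0) (hN : ContDiffAt ℝ ∞ N (coneifyPoint μ p))
    (hμ : ContDiffAt ℝ ∞ μ ‖p.2‖) (hμ0 : 0 < μ ‖p.2‖) {K₀ d₀ : ℝ}
    (hκ : |1 - ‖p.2‖ * deriv μ ‖p.2‖ / μ ‖p.2‖| ≤ K₀)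
    (hd : ‖fderiv ℝ N (coneifyPoint μ p) (0, (coneifyPoint μ p).2) - N (coneifyPoint μ p)‖ ≤ d₀) :
    ‖fderiv ℝ (coneifyMap N μ) p (0, p.2) - coneifyMap N μ p‖ ≤
      ‖p.2‖ * (1 + K₀) * d₀ / μ ‖p.2‖ := by
  rw [coneifyMap_euler_defect hp hN hμ hμ0.ne', norm_smul, Real.norm_eq_abs]
  have hκ' : |‖p.2‖ * deriv μ ‖p.2‖ / μ ‖p.2‖| ≤ 1 + K₀ := by
    have h := abs_sub (1 : ℝ) (1 - ‖p.2‖ * deriv μ ‖p.2‖ / μ ‖p.2‖)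
    rw [sub_sub_cancel, abs_one] at h
    linarith
  have hd0 : 0 ≤ d₀ := (norm_nonneg _).trans hd
  have hK : 0 ≤ 1 + K₀ := le_trans (abs_nonneg _) hκ'
  rw [abs_div, abs_mul, abs_of_nonneg (norm_nonneg _), abs_of_pos hμ0]
  calc ‖p.2‖ * |‖p.2‖ * deriv μ ‖p.2‖ / μ ‖p.2‖| / μ ‖p.2‖ *
        ‖fderiv ℝ N (coneifyPoint μ p) (0, (coneifyPoint μ p).2) - N (coneifyPoint μ p)‖
      ≤ ‖p.2‖ * (1 + K₀) / μ ‖p.2‖ * d₀ := by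
        apply mul_le_mul _ hd (norm_nonneg _) (div_nonneg (mul_nonneg (norm_nonneg _) hK) hμ0.le)
        exact div_le_div_of_nonneg_right (mul_le_mul_of_nonneg_left hκ' (norm_nonneg _)) hμ0.le
    _ = ‖p.2‖ * (1 + K₀) * d₀ / μ ‖p.2‖ := by ring

/-- **(E2) Quantitative fibre invertibility of cone-ification**: if `c_N ‖w‖ ≤ ‖DN(q)(0, w)‖` for
all `w`, `‖d‖ ≤ d₀` and `|1 − κ| ≤ K₀` (`m = μ t > 0`), then
`(c_N − K₀ d₀ / m) ‖w‖ ≤ ‖Dφ p (0, w)‖`. [folklore] -/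
theorem coneifyMap_fibre_lower_bound (hp : p.2 ≠ 0) (hN : ContDiffAt ℝ ∞ N (coneifyPoint μ p))
    (hμ : ContDiffAt ℝ ∞ μ ‖p.2‖) (hμ0 : 0 < μ ‖p.2‖) {c_N K₀ d₀ : ℝ}
    (hcN : ∀ w : F, c_N * ‖w‖ ≤ ‖fderiv ℝ N (coneifyPoint μ p) (0, w)‖)
    (hκ : |1 - ‖p.2‖ * deriv μ ‖p.2‖ / μ ‖p.2‖| ≤ K₀)
    (hd : ‖fderiv ℝ N (coneifyPoint μ p) (0, (coneifyPoint μ p).2) - N (coneifyPoint μ p)‖ ≤ d₀) (w : F) :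
    (c_N - K₀ * d₀ / μ ‖p.2‖) * ‖w‖ ≤ ‖fderiv ℝ (coneifyMap N μ) p (0, w)‖ := by
  rw [fderiv_coneifyMap_apply_inr hp hN hμ hμ0.ne' w]
  set A : F := fderiv ℝ N (coneifyPoint μ p) (0, w) with hA
  set d : F := fderiv ℝ N (coneifyPoint μ p) (0, (coneifyPoint μ p).2) - N (coneifyPoint μ p) with hd'
  set s : ℝ := ⟪‖p.2‖⁻¹ • p.2, w⟫ * (1 - ‖p.2‖ * deriv μ ‖p.2‖ / μ ‖p.2‖) / μ ‖p.2‖ with hs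
  have hd0 : 0 ≤ d₀ := (norm_nonneg _).trans hd
  have hK : 0 ≤ K₀ := (abs_nonneg _).trans hκ
  -- `|⟪ŷ, w⟫| ≤ ‖w‖`
  have ha : |⟪‖p.2‖⁻¹ • p.2, w⟫| ≤ ‖w‖ := by
    have h := abs_real_inner_le_norm (‖p.2‖⁻¹ • p.2) w
    rwa [norm_smul, norm_inv, norm_norm, inv_mul_cancel₀ (norm_ne_zero_iff.2 hp), one_mul] at h
  have hs_le : |s| ≤ ‖w‖ * K₀ / μ ‖p.2‖ := by
    rw [hs, abs_div, abs_mul, abs_of_pos hμ0]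
    exact div_le_div_of_nonneg_right (mul_le_mul ha hκ (abs_nonneg _) (norm_nonneg _)) hμ0.le
  have h2 : ‖s • d‖ ≤ ‖w‖ * K₀ / μ ‖p.2‖ * d₀ := by
    rw [norm_smul, Real.norm_eq_abs]
    exact mul_le_mul hs_le hd (norm_nonneg _) (div_nonneg (mul_nonneg (norm_nonneg _) hK) hμ0.le)
  have h3 := hcN w
  calc (c_N - K₀ * d₀ / μ ‖p.2‖) * ‖w‖ = c_N * ‖w‖ - ‖w‖ * K₀ / μ ‖p.2‖ * d₀ := by ring
    _ ≤ ‖A‖ - ‖s • d‖ := by linarith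
    _ ≤ ‖A - s • d‖ := norm_sub_norm_le A (s • d)

end Literature.Topology.FourManifolds
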